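import Summits.Ventures.PercRepro.RankLevelSetExplicitSplitArith
import Summits.Ventures.PercRepro.RankLevelSetExplicitAll
import Summits.Ventures.PercRepro.RankLevelSetDepCountSplit

/-!
# PercRepro — THEOREM P′: C-025 at EVERY level `q ≥ 3` for every `p ≥ PexpS q`, the split-count version of
THEOREM P (p9, sub-claim S4 of the crux `C025`; `proofs/SUBCLAIM-S4-p9.md`)

`c025_explicit_all` (RankLevelSetExplicitAll) with night-1's split fibre count `ncard_eRk_eq_ncard_le_le_split`
in place of `ncard_eRk_eq_ncard_le_le` on the bounded-corank core: `PexpS 3 = 5`,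
`PexpS (q+1) = max (PexpS q) (Tsplit (q+1)) + 1`, `PexpS q ≤ Tsplit q + 1 = 2^{2^{q−2}+q+5}·q² + q·2^{⌊2^q/q⌋+2q+1} + 1`
for `q ≥ 4` (`PexpS_le_Tsplit_succ`): `PexpS 4 = 163,841`, `PexpS 7 ≈ 8.6·10^14` (against `Pexp 7 ≈ 1.85·10^24`).
* **`c025_explicit_all_split`** — `∀ q ≥ 3, ∀ M [M.Finite] p, PexpS q ≤ p → RLS M p q`.
Axioms: standard.
-/

open scoped Matroid

namespace PercRepro

namespace ThmN

open Set

variable {α : Type}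

/-- **The `e`-free core at level `q ≥ 3`, bounded corank `q + 1 ≤ d ≤ q + 2^q`, rank `p ≥ Tsplit q`** — the split
fibre count `ncard_eRk_eq_ncard_le_le_split` (small closures through the rank-`(q−1)` flat bound `2^{q−1} − 1`, big
closures inside `S₀ = ⋃ circuits of ≤ q+1 elements` with `|S₀| ≤ (q+1)d`), the circuit counts, the tail and
`Explicit.poly_main_split`. -/
theorem c025_core_explicit_bounded_split (q : ℕ) (hq : 3 ≤ q) (M : Matroid α) [M.Finite] (p d : ℕ)
    (hp : Explicit.Tsplit q ≤ p) (hd1 : q + 1 ≤ d) (hd2 : d ≤ q + 2 ^ q)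
    (hR : M.eRank = (p : ℕ∞)) (hn : M.E.ncard = p + d)
    (hfree : ∀ e ∈ M.E, ∃ A ⊆ M.E \ {e}, e ∉ M.closure A ∧ e ∉ M.closure ((M.E \ {e}) \ A)) :
    RLS M p q := by
  classical
  obtain ⟨m, rfl⟩ : ∃ m, d = q + 1 + m := ⟨d - (q + 1), by omega⟩
  obtain ⟨hN₁, hP₂, h2q, h16, htail⟩ :=
    Explicit.bounds_of_two_pow_mul_sq_le q p hq ((Explicit.two_pow_mul_sq_le_Tsplit q).trans hp)
  have hq1 := Explicit.succ_le_two_pow q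
  have hEcard : M.ground_finite.toFinset.card = p + (q + 1 + m) := by
    rw [← Set.ncard_eq_toFinset_card _ M.ground_finite]; exact hn
  have hL : ∀ e ∈ M.E, ¬ M.IsLoop e := not_isLoop_of_free M hfree
  have hs : ∀ e ∈ M.E, ∀ f ∈ M.E, e ≠ f → M.eRk {e, f} = 2 := by
    intro e he f hf hef
    have h2 : (2 : ℕ∞) ≤ M.eRk {e, f} :=
      two_le_eRk_of_two_le_ncard_of_free M hfree (pair_subset he hf) (by rw [ncard_pair hef])
    have h3 : M.eRk {e, f} ≤ 2 := by
      have := M.eRk_le_encard {e, f}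
      rwa [encard_pair hef] at this
    exact le_antisymm h3 h2
  have hcirc : ∀ C, M.IsCircuit C → 3 ≤ C.encard := three_le_encard_of_circuit M hL hs
  have hflat : ∀ X ⊆ M.E, M.eRk X ≤ q → X.ncard ≤ 2 ^ q - 1 := by
    intro X hX hr
    have := ncard_add_one_le_two_pow_of_eRk_le M hL hfree q X hX hr
    omega
  have hflat' : ∀ X ⊆ M.E, M.eRk X ≤ ((q - 1 : ℕ) : ℕ∞) → X.ncard ≤ 2 ^ (q - 1) - 1 := by
    intro X hX hr
    have := ncard_add_one_le_two_pow_of_eRk_le M hL hfree (q - 1) X hX hr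
    omega
  have hd : M.E.encard = M.eRank + ((q + 1 + m : ℕ) : ℕ∞) := by
    rw [hR, ← M.ground_finite.cast_ncard_eq, hn]
    push_cast
    ring
  -- (U) with the split count
  have hU1 := Matroid.topCount_le_ncard_compl (M := M) hR hd q
  have hU2 := Matroid.ncard_eRk_eq_ncard_le_le_split M q (2 ^ q - 1) (2 ^ (q - 1) - 1) (by omega) hcirc hflat
    hflat' hd
  rw [hn] at hU2
  have hσs : ∑ j ∈ Finset.range (q + 1 + m - (q + 1) + 1), Nat.choose (2 ^ (q - 1) - 1 - q) j ≤
      2 ^ (2 ^ (q - 1) - 1 - q) :=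
    Explicit.sum_range_choose_le_two_pow _ _
  have hσ : ∑ j ∈ Finset.range (q + 1 + m - (q + 1) + 1), Nat.choose (2 ^ q - 1 - (q + 1)) j ≤
      2 ^ (2 ^ q - q - 2) := by
    have := Explicit.sum_range_choose_le_two_pow (2 ^ q - 1 - (q + 1)) (q + 1 + m - (q + 1) + 1)
    rw [show 2 ^ q - 1 - (q + 1) = 2 ^ q - q - 2 by omega] at this ⊢
    exact this
  have hhalf : q - 2 ≤ (p + (q + 1 + m)) / 2 := by omega
  have hsk : ∀ k ∈ Finset.Icc 3 (q + 1), {C | M.IsCircuit C ∧ C.ncard = k}.ncard ≤ 2 ^ (2 * q + 1 + m) := by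
    intro k hk
    rw [Finset.mem_Icc] at hk
    have hc : {C | M.IsCircuit C ∧ C.ncard = k}.ncard ≤ (q + 1 + m + (k - 1)).choose k := by
      have := Matroid.ncard_circuits_le_choose_of_encard M hd (k - 1)
      rw [show k - 1 + 1 = k by omega] at this
      exact this
    exact hc.trans ((Nat.choose_le_two_pow _ _).trans (Nat.pow_le_pow_right (by norm_num) (by omega)))
  have hsum : ∑ k ∈ Finset.Icc 3 (q + 1),
      {C | M.IsCircuit C ∧ C.ncard = k}.ncard * (p + (q + 1 + m)).choose (q + 1 - k) ≤
        (q - 1) * (2 ^ (2 * q + 1 + m) * (p + (q + 1 + m)).choose (q - 2)) := by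
    calc ∑ k ∈ Finset.Icc 3 (q + 1),
          {C | M.IsCircuit C ∧ C.ncard = k}.ncard * (p + (q + 1 + m)).choose (q + 1 - k)
        ≤ ∑ _k ∈ Finset.Icc 3 (q + 1), 2 ^ (2 * q + 1 + m) * (p + (q + 1 + m)).choose (q - 2) := by
          apply Finset.sum_le_sum
          intro k hk
          have hk' := hk
          rw [Finset.mem_Icc] at hk'
          have hmono : (p + (q + 1 + m)).choose (q + 1 - k) ≤ (p + (q + 1 + m)).choose (q - 2) :=
            Explicit.choose_le_choose_of_le_half _ _ _ (by omega) hhalf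
          exact Nat.mul_le_mul (hsk k hk) hmono
      _ = (q - 1) * (2 ^ (2 * q + 1 + m) * (p + (q + 1 + m)).choose (q - 2)) := by
          rw [Finset.sum_const, Nat.card_Icc, smul_eq_mul]
          congr 1
  have hsumb : ∑ k ∈ Finset.Icc 3 (q + 1),
      {C | M.IsCircuit C ∧ C.ncard = k}.ncard * ((q + 1) * (q + 1 + m)).choose (q + 1 - k) ≤
        (q - 1) * (2 ^ (2 * q + 1 + m) * ((q + 1) * (q + 1 + m)) ^ (q - 2)) := by
    calc ∑ k ∈ Finset.Icc 3 (q + 1),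
          {C | M.IsCircuit C ∧ C.ncard = k}.ncard * ((q + 1) * (q + 1 + m)).choose (q + 1 - k)
        ≤ ∑ _k ∈ Finset.Icc 3 (q + 1), 2 ^ (2 * q + 1 + m) * ((q + 1) * (q + 1 + m)) ^ (q - 2) := by
          apply Finset.sum_le_sum
          intro k hk
          have hk' := hk
          rw [Finset.mem_Icc] at hk'
          have hpos : 1 ≤ (q + 1) * (q + 1 + m) := by nlinarith
          have hmono : ((q + 1) * (q + 1 + m)).choose (q + 1 - k) ≤ ((q + 1) * (q + 1 + m)) ^ (q - 2) :=
            (Nat.choose_le_pow _ _).trans (Nat.pow_le_pow_right hpos (by omega))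
          exact Nat.mul_le_mul (hsk k hk) hmono
      _ = (q - 1) * (2 ^ (2 * q + 1 + m) * ((q + 1) * (q + 1 + m)) ^ (q - 2)) := by
          rw [Finset.sum_const, Nat.card_Icc, smul_eq_mul]
          congr 1
  set Ns : ℕ := (∑ j ∈ Finset.range (q + 1 + m - (q + 1) + 1), Nat.choose (2 ^ (q - 1) - 1 - q) j) *
    ∑ k ∈ Finset.Icc 3 (q + 1),
      {C | M.IsCircuit C ∧ C.ncard = k}.ncard * (p + (q + 1 + m)).choose (q + 1 - k) with hNs
  set Nb : ℕ := (∑ j ∈ Finset.range (q + 1 + m - (q + 1) + 1), Nat.choose (2 ^ q - 1 - (q + 1)) j) *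
    ∑ k ∈ Finset.Icc 3 (q + 1),
      {C | M.IsCircuit C ∧ C.ncard = k}.ncard * ((q + 1) * (q + 1 + m)).choose (q + 1 - k) with hNb
  have hNs' : Ns ≤ 2 ^ (2 ^ (q - 1) - 1 - q) * (q - 1) * 2 ^ (2 * q + 1 + m) * (p + q + 1 + m).choose (q - 2) := by
    rw [show p + q + 1 + m = p + (q + 1 + m) by ring]
    calc Ns ≤ 2 ^ (2 ^ (q - 1) - 1 - q) * ((q - 1) * (2 ^ (2 * q + 1 + m) * (p + (q + 1 + m)).choose (q - 2))) :=
          Nat.mul_le_mul hσs hsum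
      _ = _ := by ring
  have hNb' : Nb ≤ 2 ^ (2 ^ q - q - 2) * (q - 1) * 2 ^ (2 * q + 1 + m) * ((q + 1) * (q + 1 + m)) ^ (q - 2) := by
    calc Nb ≤ 2 ^ (2 ^ q - q - 2) * ((q - 1) * (2 ^ (2 * q + 1 + m) * ((q + 1) * (q + 1 + m)) ^ (q - 2))) :=
          Nat.mul_le_mul hσ hsumb
      _ = _ := by ring
  have hU : Matroid.topCount M p q ≤ (p + (q + 1 + m)).choose q + (Ns + Nb) := by
    refine hU1.trans (hU2.trans ?_)
    rw [hNs, hNb]; omega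
  -- (Y) as before
  have hY := Matroid.two_pow_le_midCount_add (M := M) p q hR
  have hA : {X : Set α | X ⊆ M.E ∧ M.eRk X ≤ q}.ncard ≤
      ∑ j ∈ Finset.range (2 ^ q - 1 + 1), (p + (q + 1 + m)).choose j := by
    calc {X : Set α | X ⊆ M.E ∧ M.eRk X ≤ q}.ncard
        ≤ {X : Set α | X ⊆ (M.ground_finite.toFinset : Set α) ∧ X.ncard ≤ 2 ^ q - 1}.ncard := by
          apply ncard_le_ncard
          · intro X hX
            exact ⟨by rw [Set.Finite.coe_toFinset]; exact hX.1, hflat X hX.1 hX.2⟩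
          · exact (Finset.finite_toSet _).finite_subsets.subset (fun X hX => hX.1)
      _ ≤ ∑ j ∈ Finset.range (2 ^ q - 1 + 1), M.ground_finite.toFinset.card.choose j :=
          ncard_subsets_ncard_le _ (2 ^ q - 1)
      _ = ∑ j ∈ Finset.range (2 ^ q - 1 + 1), (p + (q + 1 + m)).choose j := by rw [hEcard]
  have hB := Matroid.ncard_spanning_le (M := M) hd
  rw [hEcard] at hY hB
  have hT : 16 * ∑ j ∈ Finset.range (q + 2 ^ q + 1), (p + (q + 1 + m)).choose j ≤ 2 ^ (p + (q + 1 + m)) :=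
    Explicit.sixteen_mul_sum_range_choose_le (q + 2 ^ q) (p + (q + 1 + m)) (by omega)
  have hA' : ∑ j ∈ Finset.range (2 ^ q - 1 + 1), (p + (q + 1 + m)).choose j ≤
      ∑ j ∈ Finset.range (q + 2 ^ q + 1), (p + (q + 1 + m)).choose j :=
    Finset.sum_le_sum_of_subset_of_nonneg (Finset.range_mono (by omega)) (fun _ _ _ => Nat.zero_le _)
  have hB' : ∑ j ∈ Finset.range (q + 1 + m + 1), (p + (q + 1 + m)).choose j ≤
      ∑ j ∈ Finset.range (q + 2 ^ q + 1), (p + (q + 1 + m)).choose j :=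
    Finset.sum_le_sum_of_subset_of_nonneg (Finset.range_mono (by omega)) (fun _ _ _ => Nat.zero_le _)
  have hAB : 8 * ({X : Set α | X ⊆ M.E ∧ M.eRk X ≤ q}.ncard +
      {X : Set α | X ⊆ M.E ∧ M.eRk X = M.eRank}.ncard) ≤ 2 ^ (p + (q + 1 + m)) := by
    have h1 := hA.trans hA'
    have h2 := hB.trans hB'
    omega
  have hΦ := phiK_le_two_pow_div p q
  rw [Nat.choose_symm_add] at hΦ
  have hpoly := Explicit.poly_main_split q m p Ns Nb hq (by omega) hp hNs' hNb'
  rw [show p + q + 1 + m = p + (q + 1 + m) by ring] at hpoly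
  rw [RLS_iff]
  have hUq : (Matroid.topCount M p q : ℚ) ≤ ((p + (q + 1 + m)).choose q : ℚ) + ((Ns + Nb : ℕ) : ℚ) := by
    exact_mod_cast hU
  have hYq : (2 : ℚ) ^ (p + (q + 1 + m)) ≤ (Matroid.midCount M p q : ℚ) +
      ({X : Set α | X ⊆ M.E ∧ M.eRk X ≤ q}.ncard : ℚ) +
      ({X : Set α | X ⊆ M.E ∧ M.eRk X = M.eRank}.ncard : ℚ) := by exact_mod_cast hY
  have hABq : 8 * (({X : Set α | X ⊆ M.E ∧ M.eRk X ≤ q}.ncard : ℚ) +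
      ({X : Set α | X ⊆ M.E ∧ M.eRk X = M.eRank}.ncard : ℚ)) ≤ 2 ^ (p + (q + 1 + m)) := by
    exact_mod_cast hAB
  have hpolyq : 8 * (((p + (q + 1 + m)).choose q : ℚ) + ((Ns + Nb : ℕ) : ℚ)) ≤
      7 * 2 ^ (q + 1 + m - q) * ((p + q).choose q : ℚ) := by
    rw [show q + 1 + m - q = m + 1 by omega]
    exact_mod_cast hpoly
  have hU0 : (0 : ℚ) ≤ (Matroid.topCount M p q : ℚ) := Nat.cast_nonneg _
  exact level_arith (p := p) (d := q + 1 + m) (n := p + (q + 1 + m)) (q := q) rfl (by omega) hΦ hU0 hUq hYq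
    hABq hpolyq

/-- The large-corank core theorem with the threshold `Tsplit q` (the same `core_all_corank_of_thresholds_of_bound`). -/
theorem c025_core_explicit_large_split (q : ℕ) (hq : 3 ≤ q) (M : Matroid α) [M.Finite] (p : ℕ)
    (hp : Explicit.Tsplit q ≤ p) (hR : M.eRank = (p : ℕ∞)) (hbig : p + q + 2 ^ q < M.E.ncard)
    (hfree : ∀ e ∈ M.E, ∃ A ⊆ M.E \ {e}, e ∉ M.closure A ∧ e ∉ M.closure ((M.E \ {e}) \ A)) :
    RLS M p q := by
  obtain ⟨hN₁, hP₂, h2q, -, -⟩ :=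
    Explicit.bounds_of_two_pow_mul_sq_le q p hq ((Explicit.two_pow_mul_sq_le_Tsplit q).trans hp)
  have hq1 := Explicit.succ_le_two_pow q
  refine core_all_corank_of_thresholds_of_bound q (2 ^ q - 1) (by omega) (by omega)
    (2 ^ (q + 1) + 2 * q ^ 2 + 4 * q + 4) (2 ^ (q + 1) + 3 * q + 2) (fun n hn => Explicit.regime_one q n hn)
    (fun p' hp' => Explicit.regime_two q (by omega) p' hp') M p ?_ hR ?_ hfree ?_
  · exact max_le (max_le hN₁ hP₂) h2q
  · omega
  · intro j hj X hX hr
    have hL := not_isLoop_of_free M hfree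
    have h1 := ncard_add_one_le_two_pow_of_eRk_le M hL hfree j X hX hr
    have h2 := Explicit.two_pow_add_le_two_pow_add j q hj
    omega

/-- **The level step with the split threshold.** -/
theorem c025_succ_explicit_split (q : ℕ) (hq : 3 ≤ q) (P : ℕ) (hP : Explicit.Tsplit (q + 1) ≤ P)
    (hprev : ∀ (M : Matroid α) [M.Finite] (p : ℕ), P ≤ p → q + 2 ≤ p → RLS M p q) :
    ∀ (M : Matroid α) [M.Finite] (p : ℕ), P + 1 ≤ p → RLS M p (q + 1) := by
  intro M _ p hp
  have hq3 : q + 3 ≤ Explicit.Tsplit (q + 1) := by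
    obtain ⟨-, -, h, -, -⟩ := Explicit.bounds_of_two_pow_mul_sq_le (q + 1) (Explicit.Tsplit (q + 1)) (by omega)
      (Explicit.two_pow_mul_sq_le_Tsplit (q + 1))
    have := Explicit.succ_le_two_pow (q + 1)
    omega
  refine rls_succ_large (α := α) q (q + 1) P hprev ?_ ?_ M p hp (by omega)
  · intro M' _ p' _ hn _
    rcases Nat.lt_or_ge M'.E.ncard (p' + (q + 1)) with h | h
    · exact RLS_of_ncard_lt M' h
    · exact RLS_of_ncard_eq M' (by omega)
  · intro M' _ p' hP' hR hbig _ hfree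
    rcases Nat.lt_or_ge M'.E.ncard (p' + (q + 1) + 2 ^ (q + 1) + 1) with h | h
    · exact c025_core_explicit_bounded_split (q + 1) (by omega) M' p' (M'.E.ncard - p') (hP.trans hP')
        (by omega) (by omega) hR (by omega) hfree
    · exact c025_core_explicit_large_split (q + 1) (by omega) M' p' (hP.trans hP') hR (by omega) hfree

/-- **THE SPLIT THRESHOLD SEQUENCE** `PexpS`: `PexpS 3 = 5`, `PexpS (q+1) = max (PexpS q) (Tsplit (q+1)) + 1`. -/
def PexpS : ℕ → ℕ
  | 0 => 5
  | 1 => 5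
  | 2 => 5
  | 3 => 5
  | q + 4 => max (PexpS (q + 3)) (Explicit.Tsplit (q + 4)) + 1

/-- The recursion of `PexpS` at `q ≥ 3`. -/
theorem PexpS_succ (q : ℕ) (hq : 3 ≤ q) : PexpS (q + 1) = max (PexpS q) (Explicit.Tsplit (q + 1)) + 1 := by
  obtain ⟨k, rfl⟩ : ∃ k, q = k + 3 := ⟨q - 3, by omega⟩
  rfl

/-- **THEOREM P′ — C-025 AT EVERY LEVEL `q ≥ 3` FOR EVERY `p ≥ PexpS q`**, the split-count version of
`c025_explicit_all`: `PexpS q ≤ Tsplit q + 1 = 2^{2^{q−2}+q+5}·q² + q·2^{⌊2^q/q⌋+2q+1} + 1` for `q ≥ 4`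
(`PexpS_le_Tsplit_succ`) — the exponent `2^{q−2}` in place of `2^{q−1}`. -/
theorem c025_explicit_all_split (q : ℕ) (hq : 3 ≤ q) :
    ∀ (M : Matroid α) [M.Finite] (p : ℕ), PexpS q ≤ p → RLS M p q := by
  induction q, hq using Nat.le_induction with
  | base =>
    intro M _ p hp
    exact SevenThree.c025_three_all M p hp
  | succ q hq ih =>
    intro M _ p hp
    rw [PexpS_succ q hq] at hp
    refine c025_succ_explicit_split q hq (max (PexpS q) (Explicit.Tsplit (q + 1))) (le_max_right _ _) ?_ M p hp
    intro M' _ p' hP' _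
    exact ih M' p' ((le_max_left _ _).trans hP')

/-- THEOREM P′ in the literal `C025` body at `(p, q)`. -/
theorem c025_explicit_all_split' (q : ℕ) (hq : 3 ≤ q) (M : Matroid α) [M.Finite] (p : ℕ) (hp : PexpS q ≤ p) :
    phiK p q * ({A : Set α | A ⊆ M.E ∧ M.eRk A = (p : ℕ∞) ∧ M.eRk (M.E \ A) = (q : ℕ∞)}.ncard : ℚ) ≤
      ({A : Set α | A ⊆ M.E ∧ (q : ℕ∞) < M.eRk A ∧ M.eRk A < (p : ℕ∞)}.ncard : ℚ) :=
  c025_explicit_all_split q hq M p hp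

/-- **S4 — every level `q ≥ 7`, split threshold**: `RLS M p q` for every `p ≥ PexpS q`. -/
theorem c025_explicit_seven_up_split (q : ℕ) (hq : 7 ≤ q) (M : Matroid α) [M.Finite] (p : ℕ)
    (hp : PexpS q ≤ p) : RLS M p q :=
  c025_explicit_all_split q (by omega) M p hp

/-- `Tsplit` grows: `2·Tsplit q ≤ Tsplit (q + 1)` for `q ≥ 2`. -/
theorem Tsplit_le_Tsplit_succ (q : ℕ) (hq : 2 ≤ q) : 2 * Explicit.Tsplit q ≤ Explicit.Tsplit (q + 1) := by
  unfold Explicit.Tsplit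
  have h1 : 2 ^ (2 ^ (q - 2) + q + 5 + 1) ≤ 2 ^ (2 ^ (q + 1 - 2) + (q + 1) + 5) := by
    apply Nat.pow_le_pow_right (by norm_num)
    have : 2 ^ (q - 2) ≤ 2 ^ (q + 1 - 2) := Nat.pow_le_pow_right (by norm_num) (by omega)
    omega
  have h2 : q ^ 2 ≤ (q + 1) ^ 2 := Nat.pow_le_pow_left (by omega) 2
  have h3 : 2 ^ q / q ≤ 2 ^ (q + 1) / (q + 1) := by
    have hdm := Nat.div_add_mod (2 ^ q) q
    have hA : q * (2 ^ q / q) ≤ 2 ^ q := by omega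
    have hB : 2 ^ q / q ≤ 2 ^ q := Nat.div_le_self _ _
    rw [Nat.le_div_iff_mul_le (by omega), pow_succ]
    nlinarith [hA, hB]
  have h4 : 2 ^ (2 ^ q / q + 2 * q + 1 + 1) ≤ 2 ^ (2 ^ (q + 1) / (q + 1) + 2 * (q + 1) + 1) :=
    Nat.pow_le_pow_right (by norm_num) (by omega)
  calc 2 * (2 ^ (2 ^ (q - 2) + q + 5) * q ^ 2 + q * 2 ^ (2 ^ q / q + 2 * q + 1))
      = 2 ^ (2 ^ (q - 2) + q + 5 + 1) * q ^ 2 + q * 2 ^ (2 ^ q / q + 2 * q + 1 + 1) := by ring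
    _ ≤ 2 ^ (2 ^ (q + 1 - 2) + (q + 1) + 5) * (q + 1) ^ 2 + (q + 1) * 2 ^ (2 ^ (q + 1) / (q + 1) + 2 * (q + 1) + 1) :=
        Nat.add_le_add (Nat.mul_le_mul h1 h2) (Nat.mul_le_mul (by omega) h4)

/-- **THE CLOSED FORM** of THEOREM P′: `PexpS q ≤ Tsplit q + 1` for every `q ≥ 4`. -/
theorem PexpS_le_Tsplit_succ (q : ℕ) (hq : 4 ≤ q) : PexpS q ≤ Explicit.Tsplit q + 1 := by
  induction q, hq using Nat.le_induction with
  | base =>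
    show max (PexpS 3) (Explicit.Tsplit 4) + 1 ≤ Explicit.Tsplit 4 + 1
    have : PexpS 3 ≤ Explicit.Tsplit 4 := by
      show 5 ≤ Explicit.Tsplit 4
      unfold Explicit.Tsplit; norm_num
    omega
  | succ q hq ih =>
    rw [PexpS_succ q (by omega)]
    have h := Tsplit_le_Tsplit_succ q (by omega)
    have hpos : 1 ≤ Explicit.Tsplit q := by
      have h1 : 1 ≤ q ^ 2 := Nat.one_le_pow _ _ (by omega)
      have h2 : 1 ≤ 2 ^ (q + 4) := Nat.one_le_two_pow
      have h3 := Explicit.two_pow_mul_sq_le_Tsplit q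
      have h4 := Nat.mul_le_mul h2 h1
      omega
    have : max (PexpS q) (Explicit.Tsplit (q + 1)) ≤ Explicit.Tsplit (q + 1) := max_le (by omega) le_rfl
    omega

end ThmN

end PercRepro
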